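import Literature.MathematicalPhysics.QuantumFieldTheory.YangMillsOS
import Literature.MathematicalPhysics.QuantumFieldTheory.LatticeGaugeProofs
import HarnessLib

/-!
# Exact lattice translation covariance of the joint lattice `n`-point functions, eventually in `k`

Crux item `stmt-QuantumFields-16192` (`CurvatureAmnesia`), line `WardDefectSketch` — an engine brick
(card step (W-exact a), SEAM): the summation-by-parts bookkeeping of the lattice rotation-Ward
functional needs the EXACT covariance of the joint lattice `n`-point function
`latticeSchwinger ρ sch obs k n σ f` (`YangMillsOS`) under translating every test function by a
LATTICE vector `a_k • v`, `v ∈ ℤ⁴`, for all large `k`: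
`latticeSchwinger … (fun i => translateTest (a_k • v) (f i)) = latticeSchwinger … f`
(`latticeSchwinger_translate_eventually`).

Proof.  `translateTest w f x = f (x - w)`, so the smeared field of the translated test function
is `Φ_a(T_{a v} f)(W) = c a⁴ Σ_{x ∈ Λ} f(a(x - v)) (O(τₓ W) − m)`; reindexing `x = y + v` — a
bijection between the non-zero terms as soon as every `y` with `f(a y) ≠ 0` has
`y ∈ Λ ↔ y + v ∈ Λ` — gives `Φ_a(f)(τᵥ W)` with `τᵥ = configShift (-v)`
(`smearedLatticeField_translateTest_of_iff`).  On the periodic lift, `τᵥ Ũ` is the lift of the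
torus translate of `U` (`configShift_torusLift`, the pointwise form of
`toTorusObservable_comp_configShift`), and Wilson's torus measure is translation invariant
(`wilsonMeasure_map_torusConfigShift`), so the integral is unchanged (`integral_map_equiv`).
For compactly supported `fᵢ` the box condition holds for every `i` and all large `k`, because
`a_k L_k → ∞` and `a_k → 0` put both `y` and `y + v` inside the box `{-L_k, …, L_k}⁴` whenever
`‖a_k y‖ ≤ R` (`eventually_mem_box_and_mem_box`).  The one-field identity is the general-vector
analogue of `smearedLatticeField_translateTest_torusLift` (`SpeciesLatticeProducts`, time
translations of slab-supported test functions), whose `Finset.sum_bij_ne_zero` bookkeeping it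
adapts.  Nothing here is specific to the gauge group or to the observables.

References: K. Osterwalder, E. Seiler, Ann. Phys. 110 (1978) 440, §2 (translation invariance of
the periodic torus theory) — folklore.
-/

noncomputable section

namespace Summit.QuantumFields.YangMills.Cruxes.CurvatureAmnesia.WardDefect

open scoped BigOperators Topology SchwartzMap
open Filter MeasureTheory
open Literature.MathematicalPhysics.QuantumLattice Literature.MathematicalPhysics.AQFT
  Literature.MathematicalPhysics.QuantumFieldTheory
open Literature.Probability.LatticeModels (box mem_box Torus.proj)

namespace LatticeTranslation

/-! ### Lattice sites in Euclidean space -/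

section Sites

variable {d : ℕ}

/-- `siteToE` is additive: `ι(x + y) = ι(x) + ι(y)`. [folklore] -/
theorem siteToE_add (x y : Fin d → ℤ) : siteToE (x + y) = siteToE x + siteToE y := by
  ext i
  simp [siteToE_apply]

/-- `siteToE` commutes with subtraction: `ι(x - y) = ι(x) - ι(y)`. [folklore] -/
theorem siteToE_sub (x y : Fin d → ℤ) : siteToE (x - y) = siteToE x - siteToE y := by
  ext i
  simp [siteToE_apply]

/-- A coordinate of a lattice site is bounded by its Euclidean norm: `|y j| ≤ ‖ι(y)‖`. [folklore] -/
theorem abs_cast_le_norm_siteToE (y : Fin d → ℤ) (j : Fin d) : |(y j : ℝ)| ≤ ‖siteToE y‖ := by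
  have h := PiLp.norm_apply_le (siteToE y) j
  rwa [Real.norm_eq_abs] at h

/-- A lattice site of Euclidean norm at most `L` lies in the box `{-L, …, L}^d`. [folklore] -/
theorem mem_box_of_norm_siteToE_le {L : ℕ} {y : Fin d → ℤ} (h : ‖siteToE y‖ ≤ L) :
    y ∈ box d L := by
  refine mem_box.2 fun j => abs_le.1 ?_
  have hj : |(y j : ℝ)| ≤ (L : ℝ) := (abs_cast_le_norm_siteToE y j).trans h
  exact_mod_cast hj

end Sites

/-! ### Translations of configurations and the periodic lift -/

section Shift

variable {d : ℕ} {G : Type*} [MeasurableSpace G]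

/-- `τ_{y+v} = τ_y ∘ τ_v` for the translations `τ_x = configShift (-x)` of `ℤ^d`-configurations.
[folklore] -/
theorem configShift_neg_add (y v : Fin d → ℤ) (W : LGConfig d G) :
    configShift (-(y + v)) W = configShift (-y) (configShift (-v) W) := by
  funext e
  simp only [configShift_apply, sub_neg_eq_add, add_assoc]

/-- On the periodic lift a translation of `ℤ^d` is the lift of the torus translation by the
reduced vector: `configShift w (torusLift S U) = torusLift S (torusConfigShift (w mod S) U)`
(pointwise form of `toTorusObservable_comp_configShift`). [folklore] -/
theorem configShift_torusLift (S : ℕ) (w : Fin d → ℤ) (U : GaugeConfig d S G) :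
    configShift w (torusLift S U) = torusLift S (torusConfigShift (Torus.proj S w) U) :=
  congrFun (toTorusObservable_comp_configShift (G := G) S w id) U

end Shift

/-! ### One smeared field -/

section OneField

variable {G : Type} [MeasurableSpace G]

/-- **Translation covariance of one smeared lattice field.**  If every lattice point `y` at which
the test function is read off non-trivially, `f (a y) ≠ 0`, satisfies `y ∈ Λ ↔ y + v ∈ Λ`, then
smearing the translate `T_{a v} f` against `W` over `Λ` is smearing `f` against the translate
`τᵥ W = configShift (-v) W`:
`Φ_a(T_{a v} f)(W) = Φ_a(f)(τᵥ W)` (reindex `x = y + v`; general-vector analogue of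
`smearedLatticeField_translateTest_torusLift`). [folklore] -/
theorem smearedLatticeField_translateTest_of_iff (O : LGConfig 4 G → ℝ)
    (Λ : Finset (Fin 4 → ℤ)) (a c m : ℝ) (f : 𝓢(EuclideanSpace ℝ (Fin 4), ℝ)) (v : Fin 4 → ℤ)
    (W : LGConfig 4 G) (h : ∀ y : Fin 4 → ℤ, f (a • siteToE y) ≠ 0 → (y ∈ Λ ↔ y + v ∈ Λ)) :
    smearedLatticeField O Λ a c m (translateTest (a • siteToE v) f) W =
      smearedLatticeField O Λ a c m f (configShift (-v) W) := by
  simp only [smearedLatticeField]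
  refine congrArg (fun z : ℝ => c * a ^ 4 * z) ?_
  have hpt : ∀ x : Fin 4 → ℤ, a • siteToE x - a • siteToE v = a • siteToE (x - v) := fun x => by
    rw [siteToE_sub, smul_sub]
  simp_rw [translateTest_apply, hpt, ← configShift_neg_add]
  -- adapted from `smearedLatticeField_translateTest_torusLift` (SpeciesLatticeProducts)
  refine Finset.sum_bij_ne_zero (fun x _ _ => x - v) (fun x hx hne => ?_)
    (fun x₁ _ _ x₂ _ _ hx => sub_left_inj.1 hx) (fun y hy hne => ?_) (fun x _ _ => ?_)
  · exact (h _ (left_ne_zero_of_mul hne)).2 (by rwa [sub_add_cancel])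
  · exact ⟨y + v, (h _ (left_ne_zero_of_mul hne)).1 hy, by rwa [add_sub_cancel_right],
      add_sub_cancel_right y v⟩
  · rw [sub_add_cancel]

end OneField

/-! ### The box condition holds eventually along the scheme -/

section Eventually

variable {ι : Type} {n : ℕ}

/-- Along a scaling scheme (`a_k → 0`, `a_k L_k → ∞`), for compactly supported test functions
`fᵢ` and a fixed lattice vector `v`: for all large `k`, every lattice point `y` with
`fᵢ (a_k y) ≠ 0` has both `y` and `y + v` in the box `{-L_k, …, L_k}⁴`. [folklore] -/
theorem eventually_mem_box_and_mem_box (sch : SpeciesScheme ι)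
    (f : Fin n → 𝓢(EuclideanSpace ℝ (Fin 4), ℝ))
    (hf : ∀ i, HasCompactSupport (f i : EuclideanSpace ℝ (Fin 4) → ℝ)) (v : Fin 4 → ℤ) :
    ∀ᶠ k in atTop, ∀ i, ∀ y : Fin 4 → ℤ, f i (sch.a k • siteToE y) ≠ 0 →
      y ∈ box 4 (sch.L k) ∧ y + v ∈ box 4 (sch.L k) := by
  refine eventually_all.2 fun i => ?_
  obtain ⟨R, hR⟩ := (hf i).isCompact.isBounded.subset_closedBall 0
  have ht : Tendsto (fun k => sch.a k * sch.L k + -(sch.a k * ‖siteToE v‖)) atTop atTop :=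
    sch.tendsto_L.atTop_add (sch.tendsto_a.mul_const ‖siteToE v‖).neg
  filter_upwards [ht.eventually_ge_atTop R] with k hk y hy
  have ha := sch.a_pos k
  have hyR : sch.a k * ‖siteToE y‖ ≤ R := by
    have hmem := hR (subset_tsupport _ (Function.mem_support.2 hy))
    rwa [Metric.mem_closedBall, dist_zero_right, norm_smul, Real.norm_eq_abs, abs_of_pos ha] at hmem
  have hv : 0 ≤ ‖siteToE v‖ := norm_nonneg _
  refine ⟨mem_box_of_norm_siteToE_le (le_of_mul_le_mul_left ?_ ha),
    mem_box_of_norm_siteToE_le (le_of_mul_le_mul_left ?_ ha)⟩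
  · nlinarith
  · calc sch.a k * ‖siteToE (y + v)‖ ≤ sch.a k * (‖siteToE y‖ + ‖siteToE v‖) := by
          rw [siteToE_add]
          exact mul_le_mul_of_nonneg_left (norm_add_le _ _) ha.le
      _ ≤ sch.a k * sch.L k := by nlinarith

end Eventually

end LatticeTranslation

open LatticeTranslation in
/-- **Exact lattice translation covariance of the joint lattice `n`-point functions, eventually**
(crux item stmt-QuantumFields-16192, line `WardDefectSketch`, sub-goal (W-exact a, SEAM)): for
compactly supported real test functions `fᵢ` and a lattice vector `v ∈ ℤ⁴`, translating every
`fᵢ` by the physical lattice vector `a_k v` leaves the joint lattice `n`-point function of any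
species string unchanged for all large `k` — reindex the box sums, intertwine with the torus
translation through the periodic lift, and use the translation invariance of Wilson's torus
measure; "large `k`" only ensures the translated supports still fit in the box. [folklore] -/
theorem latticeSchwinger_translate_eventually : ∀ (G : Type) [Group G] [TopologicalSpace G] [IsTopologicalGroup G] [CompactSpace G] [MeasurableSpace G] [BorelSpace G] (N : ℕ) (ρ : G →* Matrix (Fin N) (Fin N) ℂ) (ι : Type) (sch : SpeciesScheme ι) (obs : ι → LGConfig 4 G → ℝ) (n : ℕ) (σ : Fin n → ι) (f : Fin n → 𝓢(EuclideanSpace ℝ (Fin 4), ℝ)), (∀ i, HasCompactSupport (f i : EuclideanSpace ℝ (Fin 4) → ℝ)) → ∀ v : Fin 4 → ℤ, ∀ᶠ k in atTop, latticeSchwinger ρ sch obs k n σ (fun i => translateTest (sch.a k • siteToE v) (f i)) = latticeSchwinger ρ sch obs k n σ f := by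
  intro G _ _ _ _ _ _ N ρ ι sch obs n σ f hf v
  filter_upwards [eventually_mem_box_and_mem_box sch f hf v] with k hk
  unfold latticeSchwinger
  conv_rhs => rw [← wilsonMeasure_map_torusConfigShift ρ (sch.β k) (Torus.proj (sch.side k) (-v)),
    integral_map_equiv]
  refine integral_congr_ae (ae_of_all _ fun U => Finset.prod_congr rfl fun i _ => ?_)
  rw [← configShift_torusLift]
  exact smearedLatticeField_translateTest_of_iff _ _ _ _ _ (f i) v _
    fun y hy => iff_of_true (hk i y hy).1 (hk i y hy).2

end Summit.QuantumFields.YangMills.Cruxes.CurvatureAmnesia.WardDefect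

end
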